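import Summits.NavierStokesRegularity.NavierStokesRegularity.Theses.HodographBetchov
import Literature.Analysis.FluidPDE.SpaceTimeRescaling
import Literature.Analysis.FluidPDE.RieszPressureL3
import Literature.Analysis.FluidPDE.SobolevWholeSpace
import Literature.Analysis.FluidPDE.LerayHopfH1Test
import Literature.Analysis.FluidPDE.ConstantinDirectionDissipationProofs
import Literature.Analysis.FluidPDE.NSWeakStrongUniquenessProofs
import Literature.Analysis.FluidPDE.TaoLocalisation
import Literature.Analysis.FluidPDE.ClassicalSolutionRescale
import Literature.Analysis.FluidPDE.SpaceTimeCalculusC1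

/-!
# Route `HodographBetchov`, support `DeepSlowGradient` (stmt-NavierStokesRegularity-15836) —
# helper file: the pressure budget on a slow cylinder and continuity of `∇u` up to the top time

The support item `Summit.NavierStokesRegularity.NavierStokesRegularity.Theses.HodographBetchov.DeepSlowGradient`:
for `ν, l, A > 0` there is `C` such that for every classical solution `(u, p)` of the unforced
Navier–Stokes system on `ℝ³ × [0, T)` which is Leray–Hopf from its rapidly decaying datum with
`∫ |u 0|² ≤ A`, every `t₀ ∈ [ν/l², T)` and every `x₀`: if `|u| ≤ l` on the backward parabolic
cylinder `[t₀ − ν/l², t₀] × B̄(x₀, ν/l)` (Reynolds number `l · (ν/l) / ν = 1`), then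
`‖∇u(t₀, x₀)‖ ≤ C`.

This helper file carries step 3 (the pressure budget, through `lintegral_rescaled_pressure_le`)
and the "continuity up to the top" half of step 4 (`mul_norm_fderiv_le_of_forall_cylinder`) of the
following proof; the assembly is `Theorems/HodographBetchovDeepSlowGradient.lean`.

## Proof of `DeepSlowGradient`

All analytic inputs are theorems of the tree.

1. *Pressure.* The classical Leray–Hopf solution is a Kato `C_t L³` solution
   (`isKatoSolutionOn_of_classical`); on a closed sub-slab `[0, S]`, `t₀ < S < T`, the space–time
   Riesz pressure `π` (`exists_spaceTime_rieszPressure`: jointly measurable, `L^{3/2}` on the slab,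
   slices `Π[u(t)]` with Stein's bound `‖π(t)‖_{3/2} ≤ C_{3/2} ‖u(t)‖₃²`) makes `(u, π)` a
   distributional solution on `(0, S) × ℝ³` (`IsKatoSolutionOn.distributional_slab_of_pressure`),
   hence on the cylinder (`IsDistributionalNSSolutionOn.mono_holds`).
2. *Normalisation.* The map `Φ(s, y) = (t₀ + (ν/l²) s, x₀ + (ν/l) y)` and the amplitude `1/l`
   rescale `(u, π)` to a distributional solution `(w, q)` with viscosity `1` on the unit cylinder
   `Q(1) = ]-1, 0[ × B(0, 1)` (`IsDistributionalNSSolutionOn.stRescale`,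
   `stAffine_preimage_cylinder_eq_parabolicCylinder`), with `|w| ≤ 1` there.
3. *Pressure budget.* `∫∫_{Q(1)} |q|^{3/2} = (l²/ν⁴)·(1/l²)^{3/2}… ≤ P(ν, l, A)`: change of variables,
   Tonelli, Stein's slice bound, `‖u‖₃³ ≤ ‖u‖₂^{3/2} ‖u‖₆^{3/2}` (Lebesgue interpolation),
   `‖u‖₆ ≤ K_S ‖∇u‖₂` (Sobolev), `‖∇u(t)‖₂^{3/2} ≤ 1 + ‖∇u(t)‖₂²`, the energy inequality
   `‖u(t)‖₂² ≤ A` and the dissipation bound `ν ∫₀ᵀ ‖∇u‖₂² ≤ A/2` of the Leray–Hopf solution.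
4. *Local regularity with constants fixed before the solution.* Seregin–Šverák's quantitative
   higher interior regularity (`NSBoundedHigherRegularityBounds_holds`, proved in the tree) gives a
   constant `K₀ = K₀(P)` and a representative `V` of `w` on `Q(1)` with `‖D_y V‖ ≤ K₀` on `Q(1/2)`;
   `V = w` on the open cylinder (both continuous), so `‖∇w‖ ≤ K₀` on `Q(1/2)`, and by continuity of
   `∇u` up to the top time `t₀ < T` the bound holds at the top centre: `‖∇u(t₀, x₀)‖ ≤ K₀ l²/ν`.

References: J. Serrin, Arch. Rational Mech. Anal. 9 (1962); G. Seregin, V. Šverák, Comm. PDE 34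
(2009) §2; L. Caffarelli, R. Kohn, L. Nirenberg, Comm. Pure Appl. Math. 35 (1982) §2 (scaling);
P. G. Lemarié-Rieusset (2016), Prop. 6.5, Thm. 15.1.
-/

noncomputable section

-- the summit and its single sub-problem share the name (CONVENTIONS §1), as in every Theorems file
set_option linter.dupNamespace false

namespace Summit.NavierStokesRegularity.NavierStokesRegularity.Theorems.DeepSlowGradient

open Set MeasureTheory Function Metric Filter Topology TopologicalSpace Literature.Analysis.FluidPDE
open scoped ENNReal NNReal

/-- **Slice bound behind the pressure budget.** For a `C¹` field `v` on `ℝ³` with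
`∫ ‖v‖² ≤ A` and any constant `C`:
`(C ‖v‖₃²)^{3/2} ≤ C^{3/2} K_S^{3/2} A^{3/4} (1 + ∫ |∇v|²_F)` — Lebesgue interpolation
`‖v‖₃ ≤ ‖v‖₂^{1/2} ‖v‖₆^{1/2}`, Sobolev `‖v‖₆ ≤ K_S ‖∇v‖₂`, `‖∇v‖ ≤ |∇v|_F` and
`x^{3/4} ≤ 1 + x`. [folklore] -/
theorem rpow_eLpNorm_three_sq_le {v : EuclideanSpace ℝ (Fin 3) → EuclideanSpace ℝ (Fin 3)}
    (hv : ContDiff ℝ 1 v) {A : ℝ} (h2 : ∫⁻ x, ‖v x‖ₑ ^ 2 ≤ ENNReal.ofReal A) (C : ℝ≥0∞) :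
    (C * eLpNorm v 3 volume ^ 2) ^ (3 / 2 : ℝ) ≤
      C ^ (3 / 2 : ℝ) * (((SNormLESNormFDerivOfEqConst (EuclideanSpace ℝ (Fin 3))
        (volume : Measure (EuclideanSpace ℝ (Fin 3))) 2 : ℝ≥0) : ℝ≥0∞) ^ (3 / 2 : ℝ) *
        (ENNReal.ofReal A ^ (3 / 4 : ℝ) *
          (1 + ∫⁻ x, ENNReal.ofReal (frobeniusNormSq (fderiv ℝ v x))))) := by
  set K : ℝ≥0 := SNormLESNormFDerivOfEqConst (EuclideanSpace ℝ (Fin 3))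
    (volume : Measure (EuclideanSpace ℝ (Fin 3))) 2 with hK
  set e2 : ℝ≥0∞ := eLpNorm v 2 volume with he2
  set e3 : ℝ≥0∞ := eLpNorm v 3 volume with he3
  set e6 : ℝ≥0∞ := eLpNorm v 6 volume with he6
  set eD : ℝ≥0∞ := eLpNorm (fderiv ℝ v) 2 volume with heD
  set D : ℝ≥0∞ := ∫⁻ x, ENNReal.ofReal (frobeniusNormSq (fderiv ℝ v x)) with hD
  -- `‖v‖₂ ≤ A^{1/2}`
  have h2' : ∫⁻ x, ‖v x‖ₑ ^ (2 : ℝ) ≤ ENNReal.ofReal A := by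
    simpa only [ENNReal.rpow_two] using h2
  have he2eq : e2 = (∫⁻ x, ‖v x‖ₑ ^ (2 : ℝ)) ^ (1 / 2 : ℝ) := by
    rw [he2, eLpNorm_eq_lintegral_rpow_enorm_toReal two_ne_zero ENNReal.ofNat_ne_top, ENNReal.toReal_ofNat]
  have he2le : e2 ≤ ENNReal.ofReal A ^ (1 / 2 : ℝ) := by
    rw [he2eq]; gcongr
  have he2fin : e2 < ⊤ :=
    he2le.trans_lt (ENNReal.rpow_lt_top_of_nonneg (by norm_num) ENNReal.ofReal_ne_top)
  -- Sobolev and `‖∇v‖ ≤ |∇v|_F`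
  have he6 : e6 ≤ K * eD :=
    eLpNorm_six_le_eLpNorm_fderiv_two volume finrank_euclideanSpace_fin hv he2fin
  have heDle : eD ≤ D ^ (1 / 2 : ℝ) := by
    rw [heD, eLpNorm_eq_lintegral_rpow_enorm_toReal two_ne_zero ENNReal.ofNat_ne_top, ENNReal.toReal_ofNat]
    exact ENNReal.rpow_le_rpow (lintegral_mono fun x => enorm_sq_le_ofReal_frobeniusNormSq
      (fderiv ℝ v x)) (by norm_num)
  -- interpolation `‖v‖₃ ≤ ‖v‖₂^{1/2} ‖v‖₆^{1/2}`
  have he3 : e3 ≤ e2 ^ (1 / 2 : ℝ) * e6 ^ (1 / 2 : ℝ) := by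
    have h := eLpNorm_le_eLpNorm_two_rpow_mul_eLpNorm_six_rpow (μ := volume)
      hv.continuous.aestronglyMeasurable (p := 3) (by norm_num) (by norm_num)
    have e : (3 : ℝ≥0∞).toReal = 3 := by norm_num
    rw [e] at h
    norm_num at h
    exact h
  -- assemble
  have h32 : (0 : ℝ) ≤ 3 / 2 := by norm_num
  calc (C * e3 ^ 2) ^ (3 / 2 : ℝ)
      = C ^ (3 / 2 : ℝ) * e3 ^ (3 : ℝ) := by
        rw [ENNReal.mul_rpow_of_nonneg _ _ h32, ← ENNReal.rpow_natCast, ← ENNReal.rpow_mul]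
        norm_num
    _ ≤ C ^ (3 / 2 : ℝ) * (e2 ^ (1 / 2 : ℝ) * e6 ^ (1 / 2 : ℝ)) ^ (3 : ℝ) := by gcongr
    _ = C ^ (3 / 2 : ℝ) * (e2 ^ (3 / 2 : ℝ) * e6 ^ (3 / 2 : ℝ)) := by
        rw [ENNReal.mul_rpow_of_nonneg _ _ (by norm_num : (0 : ℝ) ≤ 3), ← ENNReal.rpow_mul,
          ← ENNReal.rpow_mul]
        norm_num
    _ ≤ C ^ (3 / 2 : ℝ) * ((ENNReal.ofReal A ^ (1 / 2 : ℝ)) ^ (3 / 2 : ℝ) *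
          (K * D ^ (1 / 2 : ℝ)) ^ (3 / 2 : ℝ)) := by
        gcongr
        exact he6.trans (by gcongr)
    _ = C ^ (3 / 2 : ℝ) * ((K : ℝ≥0∞) ^ (3 / 2 : ℝ) *
          (ENNReal.ofReal A ^ (3 / 4 : ℝ) * D ^ (3 / 4 : ℝ))) := by
        rw [ENNReal.mul_rpow_of_nonneg _ _ h32, ← ENNReal.rpow_mul, ← ENNReal.rpow_mul]
        norm_num
        ring
    _ ≤ C ^ (3 / 2 : ℝ) * ((K : ℝ≥0∞) ^ (3 / 2 : ℝ) *
          (ENNReal.ofReal A ^ (3 / 4 : ℝ) * (1 + D))) := by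
        gcongr
        exact ENNReal.rpow_le_one_add_self D (by norm_num) (by norm_num)


/-- **The window bound.** Along a classical Leray–Hopf solution with `∫ |u 0|² ≤ A` (`A ≥ 0`),
for a time window `(a, b) ⊆ (0, T)` and a finite constant `C`:
`∫_a^b (C ‖u(t)‖₃²)^{3/2} dt ≤ C^{3/2} K_S^{3/2} A^{3/4} ((b − a) + A/(2ν))` — the slice bound
`rpow_eLpNorm_three_sq_le` integrated in time, with the energy inequality `‖u(t)‖₂² ≤ ‖u(0)‖₂²`
and the dissipation bound `ν ∫₀ᵀ∫ |∇u|²_F ≤ ½‖u(0)‖₂²` of the Leray–Hopf solution.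
[cite: Leray1934, (5.2)] -/
theorem lintegral_window_le {ν T : ℝ} {u : ℝ → EuclideanSpace ℝ (Fin 3) → EuclideanSpace ℝ (Fin 3)}
    {p : ℝ → EuclideanSpace ℝ (Fin 3) → ℝ} (hν : 0 < ν) (hT : 0 < T)
    (hcl : IsClassicalNSSolutionOn (Ico 0 T) ν 0 u p) (hLH : IsLerayHopfOn T ν 0 (u 0) u)
    {A : ℝ} (hA : 0 ≤ A) (hA0 : ∫⁻ x, ‖u 0 x‖ₑ ^ 2 ≤ ENNReal.ofReal A)
    {a b : ℝ} (ha : 0 ≤ a) (hb : b ≤ T) (C : ℝ≥0) :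
    ∫⁻ t in Ioo a b, ((C : ℝ≥0∞) * eLpNorm (u t) 3 volume ^ 2) ^ (3 / 2 : ℝ) ≤
      (C : ℝ≥0∞) ^ (3 / 2 : ℝ) * (((SNormLESNormFDerivOfEqConst (EuclideanSpace ℝ (Fin 3))
        (volume : Measure (EuclideanSpace ℝ (Fin 3))) 2 : ℝ≥0) : ℝ≥0∞) ^ (3 / 2 : ℝ) *
        (ENNReal.ofReal A ^ (3 / 4 : ℝ) *
          (ENNReal.ofReal (b - a) + ENNReal.ofReal (A / (2 * ν))))) := by
  set K : ℝ≥0 := SNormLESNormFDerivOfEqConst (EuclideanSpace ℝ (Fin 3))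
    (volume : Measure (EuclideanSpace ℝ (Fin 3))) 2 with hK
  set Df : ℝ → ℝ≥0∞ := fun t => ∫⁻ x, ENNReal.ofReal (frobeniusNormSq (fderiv ℝ (u t) x)) with hDf
  set C' : ℝ≥0∞ := (C : ℝ≥0∞) ^ (3 / 2 : ℝ) * ((K : ℝ≥0∞) ^ (3 / 2 : ℝ) *
    ENNReal.ofReal A ^ (3 / 4 : ℝ)) with hC'
  have hC'top : C' ≠ ⊤ := by
    refine ENNReal.mul_ne_top (ENNReal.rpow_ne_top_of_nonneg (by norm_num) ENNReal.coe_ne_top)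
      (ENNReal.mul_ne_top (ENNReal.rpow_ne_top_of_nonneg (by norm_num) ENNReal.coe_ne_top)
        (ENNReal.rpow_ne_top_of_nonneg (by norm_num) ENNReal.ofReal_ne_top))
  -- energy of the slices
  have hEt : ∀ t ∈ Ico 0 T, ∫⁻ x, ‖u t x‖ₑ ^ 2 ≤ ENNReal.ofReal A := by
    intro t ht
    have h1 := hLH.lintegral_enorm_sq_le hν.le ⟨ht.1, ht.2.le⟩
    have h0 : eEnergy (u 0) = ENNReal.ofReal (2 * VectorCalculus.kineticEnergy (u 0)) :=
      hLH.eEnergy_eq ⟨le_rfl, hT.le⟩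
    rw [eEnergy] at h0
    rw [← h0] at h1
    exact h1.trans hA0
  -- pointwise slice bound on the window
  have hpt : ∀ t ∈ Ioo a b, ((C : ℝ≥0∞) * eLpNorm (u t) 3 volume ^ 2) ^ (3 / 2 : ℝ) ≤
      C' * (1 + Df t) := by
    intro t ht
    have htI : t ∈ Ico 0 T := ⟨ha.trans ht.1.le, ht.2.trans_le hb⟩
    have hu1 : ContDiff ℝ 1 (u t) := (hcl.contDiff_velocity htI).of_le (by norm_cast)
    have h := rpow_eLpNorm_three_sq_le hu1 (hEt t htI) (C : ℝ≥0∞)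
    simpa only [hC', hDf, mul_assoc] using h
  -- the dissipation bound
  have hD := hLH.lintegral_frobeniusNormSq_fderiv_of_classical hcl hT
  set D : ℝ≥0∞ := ∫⁻ τ in Ioo 0 T, ∫⁻ x, ENNReal.ofReal (frobeniusNormSq (fderiv ℝ (u τ) x)) with hDdef
  have hKE : VectorCalculus.kineticEnergy (u 0) ≤ A / 2 := by
    have h0 : eEnergy (u 0) = ENNReal.ofReal (2 * VectorCalculus.kineticEnergy (u 0)) :=
      hLH.eEnergy_eq ⟨le_rfl, hT.le⟩
    rw [eEnergy] at h0
    have h1 : ENNReal.ofReal (2 * VectorCalculus.kineticEnergy (u 0)) ≤ ENNReal.ofReal A := by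
      rw [← h0]; exact hA0
    have h2 := (ENNReal.ofReal_le_ofReal_iff hA).1 h1
    linarith
  have hDle : D ≤ ENNReal.ofReal (A / (2 * ν)) := by
    have h1 : D.toReal ≤ A / (2 * ν) := by
      rw [le_div_iff₀ (by positivity)]
      have := hD.2
      nlinarith
    calc D = ENNReal.ofReal D.toReal := (ENNReal.ofReal_toReal hD.1).symm
      _ ≤ ENNReal.ofReal (A / (2 * ν)) := ENNReal.ofReal_le_ofReal h1
  -- integrate
  calc ∫⁻ t in Ioo a b, ((C : ℝ≥0∞) * eLpNorm (u t) 3 volume ^ 2) ^ (3 / 2 : ℝ)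
      ≤ ∫⁻ t in Ioo a b, C' * (1 + Df t) := setLIntegral_mono' measurableSet_Ioo hpt
    _ = C' * ((∫⁻ _t in Ioo a b, (1 : ℝ≥0∞)) + ∫⁻ t in Ioo a b, Df t) := by
        rw [lintegral_const_mul' _ _ hC'top, lintegral_add_left measurable_const]
    _ ≤ C' * (ENNReal.ofReal (b - a) + ENNReal.ofReal (A / (2 * ν))) := by
        gcongr
        · rw [setLIntegral_one, Real.volume_Ioo]
        · exact (lintegral_mono_set (Ioo_subset_Ioo ha hb)).trans hDle
    _ = _ := by rw [hC']; ring

/-- **Pressure on a cylinder from slice bounds.** If for a.e. `t ∈ (0, S)` the slice `π(t)`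
obeys `‖π(t)‖_{3/2} ≤ C ‖u(t)‖₃²`, then for `0 ≤ a`, `b ≤ S` and any spatial set `B`,
`∫∫_{(a,b)×B} |π|^{3/2} ≤ ∫_a^b (C ‖u(t)‖₃²)^{3/2} dt` (Tonelli). [folklore] -/
theorem lintegral_cylinder_pressure_le {S : ℝ} {u : ℝ → EuclideanSpace ℝ (Fin 3) → EuclideanSpace ℝ (Fin 3)}
    {π : ℝ → EuclideanSpace ℝ (Fin 3) → ℝ} {C : ℝ≥0∞}
    (hsl : ∀ᵐ t ∂(volume.restrict (Ioo 0 S)),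
      eLpNorm (π t) (3 / 2 : ℝ≥0∞) volume ≤ C * eLpNorm (u t) 3 volume ^ 2)
    {a b : ℝ} (ha : 0 ≤ a) (hb : b ≤ S) (B : Set (EuclideanSpace ℝ (Fin 3))) :
    ∫⁻ z in Ioo a b ×ˢ B, ‖π z.1 z.2‖ₑ ^ (3 / 2 : ℝ) ≤
      ∫⁻ t in Ioo a b, (C * eLpNorm (u t) 3 volume ^ 2) ^ (3 / 2 : ℝ) := by
  have h32 : (3 / 2 : ℝ≥0∞) ≠ 0 := by norm_num
  have h32' : (3 / 2 : ℝ≥0∞) ≠ ⊤ := by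
    rw [ENNReal.div_eq_inv_mul]; exact ENNReal.mul_ne_top (by simp) (by simp)
  have e32 : (3 / 2 : ℝ≥0∞).toReal = 3 / 2 := by rw [ENNReal.toReal_div]; norm_num
  -- slices
  have hslice : ∀ᵐ t ∂(volume.restrict (Ioo a b)),
      ∫⁻ x, ‖π t x‖ₑ ^ (3 / 2 : ℝ) ≤ (C * eLpNorm (u t) 3 volume ^ 2) ^ (3 / 2 : ℝ) := by
    have hsub : Ioo a b ⊆ Ioo 0 S := Ioo_subset_Ioo ha hb
    filter_upwards [ae_restrict_of_ae_restrict_of_subset hsub hsl] with t ht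
    have heq : ∫⁻ x, ‖π t x‖ₑ ^ (3 / 2 : ℝ) = eLpNorm (π t) (3 / 2 : ℝ≥0∞) volume ^ (3 / 2 : ℝ) := by
      rw [eLpNorm_eq_lintegral_rpow_enorm_toReal h32 h32', e32, one_div,
        ENNReal.rpow_inv_rpow (by norm_num)]
    rw [heq]
    gcongr
  -- Tonelli
  have hμ : (volume.restrict (Ioo a b ×ˢ (univ : Set (EuclideanSpace ℝ (Fin 3)))) :
      Measure (ℝ × EuclideanSpace ℝ (Fin 3))) =
      (volume.restrict (Ioo a b)).prod
        ((volume : Measure (EuclideanSpace ℝ (Fin 3))).restrict univ) := by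
    rw [Measure.prod_restrict, ← Measure.volume_eq_prod]
  calc ∫⁻ z in Ioo a b ×ˢ B, ‖π z.1 z.2‖ₑ ^ (3 / 2 : ℝ)
      ≤ ∫⁻ z in Ioo a b ×ˢ (univ : Set (EuclideanSpace ℝ (Fin 3))), ‖π z.1 z.2‖ₑ ^ (3 / 2 : ℝ) :=
        lintegral_mono_set (prod_mono Subset.rfl (subset_univ _))
    _ ≤ ∫⁻ t in Ioo a b, ∫⁻ x in univ, ‖π t x‖ₑ ^ (3 / 2 : ℝ) := by
        rw [hμ]; exact lintegral_prod_le _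
    _ ≤ ∫⁻ t in Ioo a b, (C * eLpNorm (u t) 3 volume ^ 2) ^ (3 / 2 : ℝ) := by
        simp only [Measure.restrict_univ]
        exact lintegral_mono_ae hslice


/-- **The pressure budget on the normalised cylinder.** Let `(u, p)` be a classical Leray–Hopf
solution on `[0, T)` with `∫ |u 0|² ≤ A` (`A ≥ 0`), `β, γ > 0`, `β ≤ t₀ ≤ S`, `t₀ ≤ T`, and let
`π` have slices with `‖π(t)‖_{3/2} ≤ C_{3/2} ‖u(t)‖₃²` for a.e. `t ∈ (0, S)`. Then the rescaled
pressure `q = α² π ∘ Φ`, `Φ(s, y) = (t₀ + β s, x₀ + γ y)`, satisfies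
`∫∫_{Φ⁻¹((t₀−β, t₀) × B(x₀, γ))} |q|^{3/2} ≤ (α²)^{3/2} (βγ³)⁻¹ C_{3/2}^{3/2} K_S^{3/2} A^{3/4} (β + A/(2ν))`
(change of variables, `lintegral_cylinder_pressure_le`, `lintegral_window_le`).
[cite: CaffarelliKohnNirenberg1982, §2 (scaling)] -/
theorem lintegral_rescaled_pressure_le {ν T S : ℝ}
    {u : ℝ → EuclideanSpace ℝ (Fin 3) → EuclideanSpace ℝ (Fin 3)}
    {p : ℝ → EuclideanSpace ℝ (Fin 3) → ℝ} {π : ℝ → EuclideanSpace ℝ (Fin 3) → ℝ}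
    (hν : 0 < ν) (hT : 0 < T)
    (hcl : IsClassicalNSSolutionOn (Ico 0 T) ν 0 u p) (hLH : IsLerayHopfOn T ν 0 (u 0) u)
    {A : ℝ} (hA : 0 ≤ A) (hA0 : ∫⁻ x, ‖u 0 x‖ₑ ^ 2 ≤ ENNReal.ofReal A)
    (hsl : ∀ᵐ t ∂(volume.restrict (Ioo 0 S)),
      eLpNorm (π t) (3 / 2 : ℝ≥0∞) volume ≤
        (steinConstThreeHalves : ℝ≥0∞) * eLpNorm (u t) 3 volume ^ 2)
    {t₀ β γ : ℝ} (hβ0 : 0 < β) (hγ0 : 0 < γ) (hβt₀ : β ≤ t₀) (ht₀S : t₀ ≤ S) (ht₀T : t₀ ≤ T)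
    (α : ℝ) (x₀ : EuclideanSpace ℝ (Fin 3)) :
    ∫⁻ z in stAffine β γ t₀ x₀ ⁻¹' (Ioo (t₀ - β) t₀ ×ˢ ball x₀ γ),
        ‖(α ^ 2 • stPull β γ t₀ x₀ π) z.1 z.2‖ₑ ^ (3 / 2 : ℝ) ≤
      ENNReal.ofReal (α ^ 2) ^ (3 / 2 : ℝ) * (ENNReal.ofReal ((β * γ ^ 3)⁻¹) *
        ((steinConstThreeHalves : ℝ≥0∞) ^ (3 / 2 : ℝ) *
          ((((SNormLESNormFDerivOfEqConst (EuclideanSpace ℝ (Fin 3))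
            (volume : Measure (EuclideanSpace ℝ (Fin 3))) 2 : ℝ≥0) : ℝ≥0∞) ^ (3 / 2 : ℝ)) *
          (ENNReal.ofReal A ^ (3 / 4 : ℝ) * (ENNReal.ofReal β + ENNReal.ofReal (A / (2 * ν))))))) := by
  set Fα : ℝ≥0∞ := ENNReal.ofReal (α ^ 2) ^ (3 / 2 : ℝ) with hFα
  have hFαtop : Fα ≠ ⊤ := ENNReal.rpow_ne_top_of_nonneg (by norm_num) ENNReal.ofReal_ne_top
  set G : ℝ × EuclideanSpace ℝ (Fin 3) → ℝ≥0∞ := fun z => ‖π z.1 z.2‖ₑ ^ (3 / 2 : ℝ) with hG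
  have hpt : ∀ z : ℝ × EuclideanSpace ℝ (Fin 3),
      ‖(α ^ 2 • stPull β γ t₀ x₀ π) z.1 z.2‖ₑ ^ (3 / 2 : ℝ) = Fα * G (stAffine β γ t₀ x₀ z) := by
    intro z
    rw [smul_stPull_apply, smul_eq_mul, enorm_mul, Real.enorm_eq_ofReal (sq_nonneg α),
      ENNReal.mul_rpow_of_nonneg _ _ (by norm_num : (0 : ℝ) ≤ 3 / 2), hG, hFα]
    simp only [stAffine_fst, stAffine_snd]
  have ha : 0 ≤ t₀ - β := by linarith
  have hfin : Module.finrank ℝ (EuclideanSpace ℝ (Fin 3)) = 3 := finrank_euclideanSpace_fin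
  calc ∫⁻ z in stAffine β γ t₀ x₀ ⁻¹' (Ioo (t₀ - β) t₀ ×ˢ ball x₀ γ),
        ‖(α ^ 2 • stPull β γ t₀ x₀ π) z.1 z.2‖ₑ ^ (3 / 2 : ℝ)
      = ∫⁻ z in stAffine β γ t₀ x₀ ⁻¹' (Ioo (t₀ - β) t₀ ×ˢ ball x₀ γ),
          Fα * G (stAffine β γ t₀ x₀ z) := lintegral_congr fun z => hpt z
    _ = Fα * (ENNReal.ofReal ((β * γ ^ 3)⁻¹) *
          ∫⁻ z in Ioo (t₀ - β) t₀ ×ˢ ball x₀ γ, G z) := by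
        rw [lintegral_const_mul' _ _ hFαtop, setLIntegral_preimage_comp_stAffine hβ0 hγ0, hfin]
    _ ≤ Fα * (ENNReal.ofReal ((β * γ ^ 3)⁻¹) *
          ∫⁻ t in Ioo (t₀ - β) t₀, ((steinConstThreeHalves : ℝ≥0∞) *
            eLpNorm (u t) 3 volume ^ 2) ^ (3 / 2 : ℝ)) := by
        gcongr
        exact lintegral_cylinder_pressure_le hsl ha ht₀S _
    _ ≤ Fα * (ENNReal.ofReal ((β * γ ^ 3)⁻¹) *
          ((steinConstThreeHalves : ℝ≥0∞) ^ (3 / 2 : ℝ) *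
            ((((SNormLESNormFDerivOfEqConst (EuclideanSpace ℝ (Fin 3))
              (volume : Measure (EuclideanSpace ℝ (Fin 3))) 2 : ℝ≥0) : ℝ≥0∞) ^ (3 / 2 : ℝ)) *
            (ENNReal.ofReal A ^ (3 / 4 : ℝ) *
              (ENNReal.ofReal (t₀ - (t₀ - β)) + ENNReal.ofReal (A / (2 * ν))))))) := by
        gcongr
        exact lintegral_window_le hν hT hcl hLH hA hA0 ha ht₀T steinConstThreeHalves
    _ = _ := by rw [sub_sub_cancel]

/-- **Continuity of the gradient up to the top time.** Let `(u, p)` be a classical solution on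
the open time set `(0, T)`, `0 < β ≤ t₀ < T`, and suppose
`c ‖∇u(t₀ + β s, x₀ + γ y)‖ ≤ K` for all `(s, y)` in the half cylinder `Q(1/2) = ]-1/4, 0[ × B(0, 1/2)`.
Then `c ‖∇u(t₀, x₀)‖ ≤ K`: the map `(t, x) ↦ ∇u(t, x)` is continuous on `(0, T) × ℝ³`
(`continuousOn_fderiv_slice_of_contDiffOn`) and the top centre `(0, 0)` lies in the closure of
`Q(1/2)`, whose image under `(s, y) ↦ (t₀ + β s, x₀ + γ y)` stays inside `(0, T) × ℝ³`. [folklore] -/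
theorem mul_norm_fderiv_le_of_forall_cylinder {ν T : ℝ}
    {u : ℝ → EuclideanSpace ℝ (Fin 3) → EuclideanSpace ℝ (Fin 3)}
    {p : ℝ → EuclideanSpace ℝ (Fin 3) → ℝ} (hclo : IsClassicalNSSolutionOn (Ioo 0 T) ν 0 u p)
    {t₀ β γ c K : ℝ} {x₀ : EuclideanSpace ℝ (Fin 3)} (hβ0 : 0 < β) (hβt₀ : β ≤ t₀) (ht₀T : t₀ < T)
    (h : ∀ z ∈ parabolicCylinder (1 / 2) ((0 : ℝ), (0 : EuclideanSpace ℝ (Fin 3))),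
      c * ‖fderiv ℝ (u (t₀ + β * z.1)) (x₀ + γ • z.2)‖ ≤ K) :
    c * ‖fderiv ℝ (u t₀) x₀‖ ≤ K := by
  set S₀ : Set ℝ := (fun s => t₀ + β * s) ⁻¹' Ioo 0 T with hS₀_def
  have hmemS₀ : ∀ s : ℝ, -(1 / 2) ≤ s → s ≤ 0 → s ∈ S₀ := by
    intro s h1 h2
    change t₀ + β * s ∈ Ioo 0 T
    have h3 : β * (-(1 / 2)) ≤ β * s := mul_le_mul_of_nonneg_left h1 hβ0.le
    have h4 : β * s ≤ 0 := mul_nonpos_of_nonneg_of_nonpos hβ0.le h2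
    constructor <;> nlinarith
  have hmaps : MapsTo (stAffine β γ t₀ x₀) (S₀ ×ˢ (univ : Set (EuclideanSpace ℝ (Fin 3))))
      (Ioo 0 T ×ˢ (univ : Set (EuclideanSpace ℝ (Fin 3)))) :=
    fun z hz => mk_mem_prod hz.1 (mem_univ _)
  set f : ℝ × EuclideanSpace ℝ (Fin 3) → ℝ := fun z =>
    c * ‖fderiv ℝ (u (t₀ + β * z.1)) (x₀ + γ • z.2)‖ with hf_def
  have hu1 : ContDiffOn ℝ 1 (uncurry u) (Ioo 0 T ×ˢ univ) := hclo.smooth_velocity.of_le (by norm_cast)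
  have hGcont : ContinuousOn (fun z : ℝ × EuclideanSpace ℝ (Fin 3) => fderiv ℝ (u z.1) z.2)
      (Ioo 0 T ×ˢ univ) :=
    continuousOn_fderiv_slice_of_contDiffOn hu1 isOpen_Ioo.uniqueDiffOn
  have hfcont : ContinuousOn f (S₀ ×ˢ (univ : Set (EuclideanSpace ℝ (Fin 3)))) := by
    have h1 : ContinuousOn (fun z : ℝ × EuclideanSpace ℝ (Fin 3) =>
        fderiv ℝ (u (stAffine β γ t₀ x₀ z).1) (stAffine β γ t₀ x₀ z).2)
        (S₀ ×ˢ (univ : Set (EuclideanSpace ℝ (Fin 3)))) :=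
      hGcont.comp (continuous_stAffine β γ t₀ x₀).continuousOn hmaps
    simp only [stAffine_fst, stAffine_snd] at h1
    exact continuousOn_const.mul h1.norm
  set A' : Set (ℝ × EuclideanSpace ℝ (Fin 3)) :=
    parabolicCylinder (1 / 2) ((0 : ℝ), (0 : EuclideanSpace ℝ (Fin 3))) with hA'_def
  have hclA_eq : closure A' = Icc (-(1 / 2) ^ 2) (0 : ℝ) ×ˢ
      closedBall (0 : EuclideanSpace ℝ (Fin 3)) (1 / 2) := by
    rw [hA'_def, parabolicCylinder, closure_prod_eq, closure_ball _ (by norm_num : (1 / 2 : ℝ) ≠ 0)]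
    have e : Ioo ((0 : ℝ) - (1 / 2) ^ 2) 0 = Ioo (-(1 / 2) ^ 2) 0 := by rw [zero_sub]
    rw [e, closure_Ioo (by norm_num)]
  have hclA : closure A' ⊆ S₀ ×ˢ (univ : Set (EuclideanSpace ℝ (Fin 3))) := by
    rw [hclA_eq]
    intro z hz
    exact mk_mem_prod (hmemS₀ z.1 (by nlinarith [hz.1.1]) hz.1.2) (mem_univ _)
  have h0A : ((0 : ℝ), (0 : EuclideanSpace ℝ (Fin 3))) ∈ closure A' := by
    rw [hclA_eq]
    exact mk_mem_prod ⟨by norm_num, le_rfl⟩ (mem_closedBall_self (by norm_num))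
  have key : f ((0 : ℝ), (0 : EuclideanSpace ℝ (Fin 3))) ≤ K :=
    le_on_closure (f := f) (g := fun _ => K) (fun z hz => h z hz) (hfcont.mono hclA)
      continuousOn_const h0A
  simpa [hf_def] using key

end Summit.NavierStokesRegularity.NavierStokesRegularity.Theorems.DeepSlowGradient

end
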